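import Summits.CriticalPhenomena.CardyFormulaZ2.Theorems.CardyIKTransportIKLinearTransportSplit
import Summits.CriticalPhenomena.CardyFormulaZ2.Theorems.CardyIKTransportIKLinearTransportFarRSWAllAspects
import Summits.CriticalPhenomena.CardyFormulaZ2.Theorems.CardyIKTransportIKLinearTransportFarRSWRingEmpty
import Summits.CriticalPhenomena.CardyFormulaZ2.Theorems.CardyIKTransportIKLinearTransportFarRSWRingHon
import Summits.CriticalPhenomena.CardyFormulaZ2.Theorems.CardyIKTransportIKLinearTransportQuenchedLongCross
import Summits.CriticalPhenomena.CardyFormulaZ2.Theorems.CardyIKTransportIKLinearTransportQuenchedRingBlocking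
import Summits.CriticalPhenomena.CardyFormulaZ2.Theorems.CardyIKTransportIKLinearTransportQuenchedRingOfHarris
import Summits.CriticalPhenomena.CardyFormulaZ2.Theorems.CardyIKTransportIKMixedBoxCrossingQuenchedFamOfVariance
import Summits.CriticalPhenomena.CardyFormulaZ2.Theorems.CardyIKTransportIKMixedBoxCrossingQuenchedMixture
import Summits.CriticalPhenomena.CardyFormulaZ2.Theorems.CardyIKTransportIKMixedBoxCrossingQuenchedHarris
import Summits.CriticalPhenomena.CardyFormulaZ2.Theorems.CardyIKTransportIKMixedBoxCrossingQuenchedLogSupermodular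
import Summits.CriticalPhenomena.CardyFormulaZ2.Theorems.CardyIKTransportIKLinearTransportQuenchedApproxHarrisSeparated
import Summits.CriticalPhenomena.CardyFormulaZ2.Theorems.CardyIKTransportIKLinearTransportQuenchedIsoTJunction

/-!
# Line `pinned-diagram-exchange` — crux `CardyIKTransport.IKLinearTransport` (stmt-CriticalPhenomena-5076)
# SKELETON v31 (lead gen 1, continuation seat c9, prover-line-stmt-CriticalPhenomena-5076-c9-0, 2026-08-17) — THE TYPED SPLIT FORM; v29–v31 RESHAPE THE TWO RSW RESIDUES INTO ASSEMBLIES OVER THE SHARED QUENCHED CORE, NOW REGISTERED AS `QuenchedVarianceDecay` (see the end of this header)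

Vocabulary: `…IKLinearTransportLine.lean` (p74749), glue `…IKLinearTransportGlue.lean` (p92088), PinnedDefs
(p93016), RowCFTP vocabulary `…StubPinnedSamplerRowCFTP.lean` + `…RowCFTPFinal.lean` (p112711).
LANDED registered stubs, IMPORTED (six of the original nine + the coding step of PinnedSampler):
`stub_TriLawOfEmpty` p83265 · `stub_DiagramExchange` p91210 · `stub_CouplingToLimits` p91892 ·
`stub_CrudeCardySiteTri` p93655 · `stub_ExchangeAssembly` p93768 · `stub_StripDiagramExchange` p97886 ·
`pinnedSampler_of_uniformRowCFTP` p112711 (PinnedSampler ⇐ (A_dyn)).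
RESHAPE v8 (this seat): the research stub `stub_ConditionalRSW` (conditional RSW uniform in the pattern and in
the far conditioning) is replaced by
* `stub_MixedRSW` := the route decl `Theses.CardyIKTransport.IKMixedBoxCrossing` (crux r4, stmt-5911 — the
  genuinely open RSW-without-FKG content, owned by its own lines; closes here when `IKMixedBoxCrossing_holds` lands),
* `stub_Screening` — far-field RATIO WEAK MIXING of the gauge colour field at distance `n` (provable: the
  plaquette array between the box and the far region screens the conditioning at rate `(7-4√3)^n`, an
  `𝔽₂`-Fourier computation; sub-goals `screeningArray`, `screeningOffset`, `screeningGauge` + the lead's assembly),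
* the glue `conditionalRSW_of_screening` (§0 below, sorry-free; being landed as
  `Theorems/CardyIKTransportIKLinearTransportScreeningGlue.lean`, after which §0 is replaced by that import).
v9 (after wave 1 of this seat): glue `conditionalRSW_of_screening` LANDED (p116422) and imported; the finite-array
half of `stub_Screening` LANDED (`screeningArray` p119372, `screeningOffset` p118204) with the gauge identities
(p117282) and the assembly vocabulary (p119854) — the assembly sub-goals are registered; `stub_RowCFTP` reduced to
(A_dyn') `stub_CoalescingRowKernel` by the landed exact row dynamics (p118192) and `rowCFTP_of_coalescingRowKernel`
(p119461).
v10 (after wave 2): `stub_Screening` PROVED and imported (`…IKLinearTransportScreening{,2}.lean`);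
`stub_LinearTransport` reshaped to `stub_WindowTransport` over the landed `stripLaw`/`couplingLift`/composition;
`stub_CoalescingRowKernel` reshaped to (K) `stub_CutMarkovKernel` + (Loc) `stub_CutMarkovLocal` over the landed
cut-row machinery (tail PROVED).
v11 (after wave 3): (K) `stub_CutMarkovKernel` PROVED (p126568 + 7 helper files) and imported; (Loc) PROVED for every
two-sided-local version (p124599) with the transfer (K₂) ⇒ (Loc) (p125069); the screening estimate in exact /
product form for all aspect ratios LANDED (`screeningArrayExact` p124139, `sigmaExact_small` p124254).
v11 OPEN: `stub_TwoSidedCutMarkovKernel` (K₂), `stub_MixedRSW` (= stmt-5911, external), `stub_WindowTransport` (S₂, XL).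
v12 (seat c2, one wave): (K₂) `stub_TwoSidedCutMarkovKernel` PROVED and imported (`…TwoSidedKernelFinal.lean`: the
canonical ATOM version `tcK` between the last cut below and the first cut above row `0` — vocabulary `…TwoCutDefs` p127679,
two-cut combinatorics `stub_TwoCutComb` (W1), rectangle property in the cut-adapted gauge `stub_TwoCutGauge` (W2, p128444),
abstract rectangle identity `stub_RectIdentity` (W3, p128331), kernel/ReadsEnv p128358, law p128508) — hence (Loc),
(A_dyn'), (A_dyn), PinnedSampler and THE BET `pinnedExchange` (Manolescu Fact 5.15 for IK, FKG-free) are THEOREMS;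
`stub_MixedRSW` bridged to the r4 decl of CardyDiluteOrbit (`mixedBoxCrossing_iff`, by `Iff.rfl`).
v12 OPEN: `stub_MixedRSW` (= stmt-5911, external), `stub_WindowTransport` (S₂, XL, PROMOTE: see
Cruxes/IKLinearTransport/WindowTransport-promote-c2.md and LinearTransport-reshape.md).
v13 (seat c3): RESHAPE of `stub_WindowTransport` at the skeleton level along the c1 audit (the registered
a-priori hypothesis `CondRSWBound` — aspect 2, lower bound only — is weaker than what the only known proof,
arXiv:2502.08394 §5.3, consumes): the composition now runs through the landed `linearTransport_of_parts_far`
(p121134) with the kernel hypothesis DISCHARGED by `exchangeKernels_IK` (p129266), and the stub is split into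
* `stub_RatioMix` — DENSITY-form ratio mixing at all aspect ratios (provable: product-form screening
  `screeningArrayExact` p124139 / `sigmaExact_small` p124254 + a multiplicative offset lemma + the multiplicative
  endgame p128820; registered sub-goals `screeningOffsetMul`, `screening_master_mul`, `ratioMix_of_masterMul`),
* `stub_FarRSWInputs` — the UNCONDITIONAL far RSW family (all-aspect crossings + black rings, uniformly in the
  pattern) from the route crux r4: FKG-free gluing, r4-adjacent research,
* `stub_FarRSWOfInputs` — conditioning on far events is free given ratio mixing (large scales) and finite
  energy (small scales): provable glue,
* `stub_WindowTransportFar` — Manolescu §5.3.2–§5.3.6 given kernels + far RSW + ratio mixing: the honest XL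
  core (PROMOTE candidate; statement = the middle hypothesis of `linearTransport_of_parts_far`).
v13 OPEN: `stub_MixedRSW` (= stmt-5911, external), `stub_RatioMix` (wave c3), `stub_FarRSWInputs`
(research), `stub_FarRSWOfInputs` (wave c3), `stub_WindowTransportFar` (XL, promote).
v14 (seat c3, after wave 1 — all four workers landed): `stub_RatioMix` PROVED (composition of the landed sub-goals
`screeningOffsetMul` p130428, `screening_master_mul` p130394, `ratioMix_of_masterMul` p130455) and
`stub_FarRSWOfInputs` PROVED BY NAME (p130895, prep p130797) and imported: density-form ratio mixing at all
aspect ratios and "conditioning on far events is free" are THEOREMS of the line.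
OPEN (the only `sorry`s): `stub_MixedRSW` (= stmt-5911, external), `stub_FarRSWInputs` (FKG-free gluing to all
aspects + rings, r4-adjacent research), `stub_WindowTransportFar` (XL, PROMOTE).
v15 (seat c4): RESHAPE of `stub_WindowTransportFar` — the provable plumbing is carved out of the XL stub so that the
promoted core is exactly the probabilistic heart: (M0) `stub_ExchangeChain` (composition of the landed kernels along any
admissible schedule as ONE map of kernel shape: law transport, a.s. invariance off the swept columns, covariance),
(A2) `stub_FarRSWWhite` (the far family for white by colour-flip symmetry), (A1) `stub_OneArmDecay` (uniform polynomial
one-arm decay of either colour from the far-conditioned rings, peeling nested annuli from the inside), and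
`stub_WindowTransportCore` (the far statement with chain / white family / arm decay as extra hypotheses; PROMOTE
candidate); `stub_WindowTransportFar` is DERIVED (`ringFamily_false_of_far`, `ringFamily_true_of_white`, composition).
v15 OPEN: `stub_MixedRSW` (ext), `stub_FarRSWInputs` (research), `stub_ExchangeChain` (wave c4), `stub_FarRSWWhite`
(wave c4), `stub_OneArmDecay` (wave c4), `stub_WindowTransportCore` (XL, promote).
v16 (seat c4, after wave 1 — all three workers landed): `stub_ExchangeChain` PROVED (p132248: even/odd split of the fresh
randomness `beta_map_split`, one-step measure preservation, induction on the schedule), `stub_FarRSWWhite` PROVED (p132129: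
`map_flip_νmix`, flip-invariance of far-determinedness, `monoPaths_flip_true`), `stub_OneArmDecay` PROVED (p132765 + geometry
p132417: annular witnesses `oad_annular_witness`, level events determined far from lower levels, inside-out peeling `oad_peel`,
margins `(3^j-1)(n+1)`, `λ = -log(1-min c ½)/log 3`) and imported.
v17 (seat c4, wave 2): the domain-Markov primitive of the resampling step is carved out of the core as well —
`stub_BoxResampler` (Markov box resampler of every `ν_S`: law preservation, layer-measurability, finite energy;
provable from the r4 line's `BridgeLaw` + finite Gibbs algebra) becomes a hypothesis of `stub_WindowTransportCore`;
the finite TRANSPARENCY identity `exchangeChain_transparency` (registered sub-goal; evaporating columns changes no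
event invariant under the swept data) rides as a `--supports` lemma.
v18 (seat c4, after wave 2 — both workers landed): `stub_BoxResampler` PROVED (p135279 + p134204/p134364/p135180,
`Kc = 256`) and `exchangeChain_transparency` PROVED (p133296), imported.
v19 (seat c4, wave 3): per-step access to the chain carved out as well — `stub_ChainSteps` (states `X t`, step randomness
`U t`, joint law `ν_{S t} ⊗ β` of (state, step randomness), same locality constants) becomes a hypothesis of the core.
v20 (seat c4, after wave 3): `stub_ChainSteps` PROVED (p135699) and imported. Every input of Manolescu's §5.3 that is
provable inside the line is now a LANDED theorem and a hypothesis of the core: kernels, chain (endpoint + per-step),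
Markov box resampler, white far family, ratio mixing, one-arm decay (both colours); the far family for black enters
through `stub_FarRSWInputs` + stmt-5911.
OPEN (the only `sorry`s): `stub_MixedRSW` (= stmt-5911, external), `stub_FarRSWInputs` (FKG-free gluing, research),
`stub_WindowTransportCore` (XL, PROMOTE — dossier `Cruxes/IKLinearTransport/WindowTransportCore-promote-c4.md`).
v21 (seat c5): stubs and composition UNCHANGED (re-registered by the continuation seat); the lead holds `stub_FarRSWInputs`
(FKG-free gluing; dossier `Cruxes/IKLinearTransport/FarRSWInputs-c5.md`: high-temperature structure of the colour field,
tanh K = 7 - 4√3, Dobrushin constant, Edwards–Sokal-type representation; nearest prior art Beffara–Gayet arXiv:1710.10644).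
v22 (seat c6): stubs and composition UNCHANGED (re-registered by the continuation seat). Calibration recorded by this seat: the
two RSW stubs are instances of a recognised OPEN PROBLEM CLASS — box-crossing at criticality for a planar field without positive
association (Beffara–Gayet arXiv:1710.10644: perturbative only, non-perturbative version = their open question 1;
Muirhead–Rivera–Vanneuville arXiv:2010.11770, Ann. Probab. 2023: FKG replaced by sprinkling, hence nothing AT the critical
level, their Conj. 1.11 open). No delegable stub; no wave. Lead work: rotational-invariance falsifier of the crux (kit) and the
planner recommendation (promote the c4/c5 dossier stubs; park the crux behind stmt-5911).
v23 (seat c6, RESHAPE = COARSENING to the crux-strategist's typed split, glue LANDED p138980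
`…Theorems/CardyIKTransportIKLinearTransportSplit.lean`): the registry is re-cut at ROUTE-ITEM granularity — exactly TWO stubs, the
proposed route children written INLINE over Literature vocabulary (verbatim the statements of `Cruxes/IKLinearTransport/Lines/far_window_split.lean`
and of `children.json` on the item, seat planner-cstrat-stmt-CriticalPhenomena-5076-s1-0):
* `stub_IKFarRSW` ⊇ v22's `stub_MixedRSW` + `stub_FarRSWInputs` (the unconditional far RSW family, all aspects + black rings, ∀ S; v22's
  `stub_FarRSWInputs` statement is DERIVED below as `farRSWInputs_of_IKFarRSW`; `stub_MixedRSW` is the route item stmt-5911 itself);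
* `stub_IKWindowTransport` = v22's `stub_WindowTransportCore` with its seven PROVED hypotheses discharged (kernels `exchangeKernels_IK`,
  chain p132248, per-step chain p135699, box resampler p135279, white family p132129, ratio mixing p130455, arm decay p132765) and the far
  family as its only hypothesis — so v22's core statement follows from it by weakening.
Composition: the LANDED `IKLinearTransport_of_subs` (p138980). Sorries 3 → 2; both are the crux's research content (dossiers
`FarRSWInputs-promote-c5.md` + line report c6 §2, `WindowTransportCore-promote-c4.md`; calibration: FKG-free critical RSW = Beffara–Gayet
arXiv:1710.10644 Q1 / Muirhead–Rivera–Vanneuville arXiv:2010.11770 Conj. 1.11). When the planner runs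
`ledger route edit --split IKLinearTransport --into IKFarRSW IKWindowTransport`, these two stubs ARE the children and the glue item closes by
`exact IKLinearTransport_of_subs`.
LANDED FRAGMENTS of `stub_IKFarRSW` (seat c6, `…Theorems/CardyIKTransportIKLinearTransportFarRSWFragments.lean`, p139406 + p139595 +
p139654; registered sub-goals): `ikFarRSW_tbCross_two` / `ikFarRSW_tbCross_le_two` — the FULL bottom–top clause at aspect bound k = 2 for
EVERY pattern S (from the sister line's landed `verticalClause`, stmt-5911 p138511, Yang–Baxter monotone transport) — and
`ikFarRSW_lrCross_two_iso` / `ikFarRSW_lrCross_le_two_iso` — the left–right clause at k = 2 on boxes with isotropic interior face columns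
(from the landed `PureIKBoxCrossing`, quarter turn). Open inside `stub_IKFarRSW`: the mixed-box horizontal clause (5911's last sorry
`stub_csmColIneq`), aspect bounds k > 2, and the rings (FKG-free gluing).
v24 (seat c7): stubs and composition UNCHANGED (re-registered by the continuation seat). NEW this seat: the sister line's monotone
Yang–Baxter transport is NOT tied to aspect 2 — `LastColLinkMono`/`ArcsIsoGeHon`/`CylBunching` hold for every slab width and the
`CylPlane` helpers for every band width — so shrinking the slab width by a factor `K` turns site-𝕋's RSW at aspect `≍ K` into the
bottom–top clause at aspect `K` for EVERY pattern `S`, and (quarter turn) into BOTH clauses at every aspect for isotropic boxes: the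
isotropic Izergin–Korepin model gets the box-crossing property at ALL aspect ratios without FKG (file
`…Theorems/CardyIKTransportIKLinearTransportFarRSWAllAspects.lean`, this seat). Open inside `stub_IKFarRSW` after v24: the mixed-box
horizontal clause (stmt-5911 `HorizontalClause`) and the RINGS (4-rectangle gluing; FKG-free circuit construction) only.
v25 (seat c7, after wave 1 — both files LANDED: `…FarRSWAllAspects.lean` p146877 = `ikFarRSW_tbCross_all` (TB clause ∀S ∀k),
`ikFarRSW_lrCross_all_iso`, `ikFarRSW_cross_all_hon`, `pureIK_boxCrossing_allAspects`; `…FarRSWRingEmpty.lean` p146942 =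
`ikFarRSW_ring_empty` (ring clause ∀k at S = ∅)): RESHAPE of `stub_IKFarRSW` into its two genuine residues over the line's vocabulary —
* `stub_lrCrossAll` — the LEFT–RIGHT clause for EVERY pattern at every aspect bound (⊇ stmt-5911's `HorizontalClause` = aspect 2; for
  mixed boxes there is no quarter turn, so aspects k > 2 need horizontal gluing as well; landed special cases: isotropic-interior and
  honeycomb boxes, all k);
* `stub_ringAll` — the RING clause for EVERY pattern at every aspect bound (landed special case: S = ∅; for isotropic boxes this is the
  four-long-crossings gluing, the FKG-free residue proper — it contains the same boundary-junction estimate as stmt-5911's residue);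
composed with the LANDED `ikFarRSW_tbCross_all` into the far family (`farFamily_of_clauses`, glue below) and into the inline route child by the
LANDED `IKFarRSW_of_farFamily` (p138980): `stub_IKFarRSW` is now DERIVED. Sorries: `stub_lrCrossAll`, `stub_ringAll`, `stub_IKWindowTransport`.
v26 (seat c7, after wave 2): stubs and composition UNCHANGED; LANDED meanwhile `…FarRSWRingHon.lean` p149042 = `ikFarRSW_ring_hon` (the ring clause
for EVERY pattern on honeycomb column regions: strip locality `stripLaw` + `ring_mem_determinedOn_colStrip` + p146942) and (proposed)
`…HardCrossingDecay.lean` = `pureIK_hardCrossing_decay` (hard crossings of long isotropic boxes decay geometrically in the aspect ratio — the FKG-free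
upper half of RSW; `pureIK_easyCrossing`: short-way crossings of long isotropic boxes are exponentially certain). So inside `stub_ringAll` the open part is
exactly: rings around boxes whose (n+1)-column-neighbourhood meets `S` (for isotropic regions: the four-long-crossings frame = the junction estimate in
hook form, `Cruxes/IKLinearTransport/RingsIsoNegative-c7.md`); inside `stub_lrCrossAll`: LR of boxes whose columns meet both `S` and `Sᶜ`.v27 (seat c8, prover-line-stmt-CriticalPhenomena-5076-c8-0): stubs and composition UNCHANGED (re-registered).  NEW, LANDED as fragments of
`stub_ringAll` (wave 1 of this seat, nine files `…Theorems/CardyIKTransportIKLinearTransportWallDomination{Defs,H1Gen,LinkConst,Perm,LastColMono,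
OneWall,Product,Rot,TwoWall}.lean` + the assembly `…WallDomination.lean`): WALL DOMINATION — an FKG SUBSTITUTE ACROSS A COLUMN.  The sister line's 1D link
lemma is general in the event (its `LinkTelescope` is stated for every increasing function of the gap-crossing vector) and pointwise in the interior, so
(`oneWallDomination`) for EVERY face-type pattern τ every event increasing in the black-connectivity profile of the wall column of a cylinder slab — cut
down by any wall-colouring event, i.e. CONDITIONALLY on the wall — has probability ≥ its site-𝕋 probability; the slab weight factorises over the two
half-slabs of any column, the π-rotation maps a left half-slab to a standard one (anti ↦ anti), and the fibrewise dominations compose by iterated sums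
(`twoWallDomination`): every event increasing in the PAIR of profiles (left, right) of one column has ν_τ-probability ≥ its site-𝕋 probability — in 𝕋
Harris glues the two sides, and the pinned coincidence at the wall (RingsIsoNegative-c7 §4) is inherited.  Exact enumeration (compute/halfslab.c, w ≤ 2
per side, L ≤ 8, all τ, all wall colourings, all principal up-sets) confirms both to 1e-16; the planar FREE box (compute/openslab.c) and the three-side-pinned
corner box (compute/cornerbox.c) FAIL (boundary rows; pinned diagonals), so the cylinder is essential and there is no pointwise "corner transport".
HONEST LIMIT (hugging argument, report c8 §3): profile events of one wall cannot force band-confined or fat rings (any pair of profiles is realised by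
configurations black only in the columns x₀ ± 1, and on the cylinder by wrong-way paths), so `stub_ringAll` in its registered thin-annulus regime
n ≤ w is NOT reached; what wall domination gives planarly (pure-isotropic neighbourhoods, via CylPlane band transfer + hard-crossing decay p149831 +
a lattice Jordan lemma not yet in the tree) is thin rings around wall segments inside thick neighbourhoods and polynomial wall-avoiding half-plane arm decay.
v28 (seat c8, end of cycle 8): stubs and composition UNCHANGED.  LANDED meanwhile (all `--supports`, files `…Theorems/CardyIKTransportIKLinearTransport…`):
WAVE 2 — `…WallDominationRingDefs/HonThinRing/HonThinRingMargin/Ring/RingMargin`: THIN RINGS THROUGH THE WALL FOR EVERY PATTERN on cylinders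
(`WallDomination.thinRingChain_all`: circumference 8n, windows [2n,3n), [5n,6n); `WallDomination.thinRingChain_margin_all`: circumference 2M+7s+1 with free
margins of any height M, constant independent of M — site-𝕋 RSW + Harris + wall-visit decomposition on the honeycomb side, `twoWallDomination` for the
transfer); `…ThetaEnclosure{Winding,Refine,,Chain}`: the LATTICE JORDAN LEMMA for the cell triangulation with one diagonal per face
(`PinnedDiagramExchange.thetaEnclosure`, `…thetaEnclosureChain`: a black theta-graph through the wall around a wall segment blocks every white escape; discrete
winding engine `walkWinding` of PlanarDuality + a colour-dependent scale-2 refinement); `…WallDominationBoxRead` (`nuMix_boxReadQ_eq_qProb`: planar free-box law =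
ν_S law of the box reading, every event), `…WallDominationBandLower` (`qProb_le_cylProb_band`, converse band comparison 25/16); `…HardCrossingDecayAll`
(`HardCrossingDecay.hardCrossing_decay_all`, `easyCrossing_all`: for EVERY pattern S, LR hard crossings of (2m+1)n × n boxes have probability ≤ θ^m and TB easy
crossings ≥ 1 − θ^m, n ≥ N — c7's squares + ratio mixing + `verticalClause_aspect 1`).  WAVE 3 — `…WallDominationPlanarDefs/BoxPlanar/ObsRing/Shift/CylSubsetAux/
Planar`: the PLANAR TRANSFER for pure-isotropic neighbourhoods (`WallDomination.thinRing_planar_iso_of`: cylinder thin ring ∀τ ⟹ band comparison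
`CylPlane.cylProb_bandQ_le` ⟹ planar box reading ⟹ blockers by `pureIK_hardCrossing_decay_tb` ⟹ `thetaEnclosureChain` ⟹ a black ring around a planar wall
segment of length s inside its O(s)-neighbourhood with ν_univ-probability ≥ c; the cylinder-side inclusion needs margins M ≥ 1 — `ThinRingCylSubset` as first
stated is FALSE at M = 0, corrected `thinRingCylSubset_pos`).  NEW NEGATIVES (numerics, lead folder compute/): the TRANSPOSED wall (a pinned ROW, perpendicular
to the type stripes; rowwall.c) does NOT dominate for mixed patterns (hon > τ by 1e-2 conditionally, 8e-4 unconditionally at LX = 5) — wall domination is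
stripes-parallel, so the ∀S blockers of `hardCrossing_decay_all` cannot be paired with it to reach `stub_lrCrossAll`; the "half-plane arm decay" of v27 is
WITHDRAWN (wall-hugging chords enclose nothing off the wall); in the corner box, handle events among wall cells at distance ≥ 2 from the pinned rows show no
violation at the enumerated sizes (cornerbox.c W ≤ 2, H ≤ 7) — a corner transport for corner-avoiding events is numerically alive, unproved.
v29 (seat c9, prover-line-stmt-CriticalPhenomena-5076-c9-0, 2026-08-17): RESHAPE onto the sister crux's new lever.  stmt-5911's lead merged the
strategist's ALT line `quenched-chain-fkg` (13:20Z): the colour law of EVERY `ν_S` is an EXACT mixture, over a colourless defect environment ξ, of Harris–FKG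
measures (three-point chain decomposition, proved), so `ν_S(∩ A_i) ≥ E_ξ ∏ P_ξ(A_i)`; its consequence form `QuenchedChainFKG.ApproxHarrisFam` (approximate Harris
for boundedly many macroscopic box-crossing events, uniformly in `S`) is LANDED as a def (p162432) with the planar `glueStep`, `bottomRowFloor`, `Harris7OfFam`.
With that gluing inequality both RSW residues of this line are ASSEMBLIES: `stub_lrCrossAll` and `stub_ringAll` are now DERIVED from
* `stub_MixedRSW` := the route decl `IKMixedBoxCrossing` (external, stmt-5911; gives `Split.HorizontalClause`, p143979),
* `stub_approxHarrisFam` := `QuenchedChainFKG.ApproxHarrisFam` VERBATIM — the ONE core statement now shared by the live skeletons of BOTH cruxes (strategist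
  census s2, R2: staffed, narrowed and disproved once),
* three PROVABLE stubs over the vocabulary `…IKLinearTransportQuenchedAssemblyDefs.lean` (this seat; inlined in §A below until it lands, then imported):
  `stub_longCrossOfHarris` (LR ∀S ∀k: ladder of `2h × h` boxes glued by `glueStep` through BT crossings of the `h × h` overlaps + ONE approximate Harris +
  `bottomRowFloor` at the finitely many small scales), `stub_ringBlocking` (deterministic: black long-way crossings of the four frame strips confine every white
  path meeting the box — first exit from the enlarged box + `GlueStep.meet`, general diagonals), `stub_ringOfHarris` (rings ∀S ∀k: approximate Harris for the
  four strips + LR/TB ∀k + the all-black box by finite energy at small scales).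
Sorries: `stub_MixedRSW` (ext), `stub_approxHarrisFam` (shared core), `stub_longCrossOfHarris`, `stub_ringBlocking`, `stub_ringOfHarris` (wave c9),
`stub_IKWindowTransport` (XL).  After the wave the crux's open content is exactly {stmt-5911, ApproxHarrisFam, IKWindowTransport}.
v30 (seat c9, after wave 1 — ALL THREE provable stubs LANDED within 75 minutes of the reshape: `stub_longCrossOfHarris` p165748 `…QuenchedLongCross.lean`,
`stub_ringBlocking` p166310 `…QuenchedRingBlocking.lean`, `stub_ringOfHarris` p166629 `…QuenchedRingOfHarris.lean`; vocabulary p165165 `…QuenchedAssemblyDefs.lean`)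
and imported.  OPEN (the only `sorry`s): `stub_MixedRSW` (= stmt-5911, external), `stub_approxHarrisFam` (= 5911 v7 `ApproxHarrisFam` verbatim — THE shared core),
`stub_IKWindowTransport` (XL, promote).  I.e. modulo the window transport, Cardy-for-IK's far RSW family (all aspects, both directions, rings, every column pattern)
is now EXACTLY {HorizontalClause of 5911, ApproxHarrisFam}.
v31 (seat c9, 15:40Z): the sister line LANDED its whole quenched layer today (exact mixture (M) p·QuenchedMixture, log-supermodularity (L), quenched Harris (H),
annealed bound (A), telescoping (F) `stub_approxHarrisFamOfVariance`), so `ApproxHarrisFam ⇐ QuenchedVarianceDecay` (V) is a landed implication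
(`approxHarrisFam_of_quenchedLayer`): `stub_approxHarrisFam` is now DERIVED and the shared core is registered one level deeper, as
`stub_quenchedVarianceDecay := QuenchedChainFKG.QuenchedVarianceDecay` VERBATIM (5911 v8's only concentration stub).  Wave 2 of this seat LANDED two fragments of
the core: `approxHarris_separated` (p168538: the k = 2 case of `ApproxHarrisFam` HOLDS for boxes at sup-distance ≥ n, by the landed ratio mixing — the core is about
adjacent/overlapping boxes only) and `isoTJunctionFamily_of_approxHarris` (p168874: the strategist's typed core target `IsoTJunctionFamily` ⊆ the shared core).
Sorries: `stub_MixedRSW` (= stmt-5911 ↔ TallEasyTransverse given the core, `QuenchedResidue`), `stub_quenchedVarianceDecay` (THE shared core), `stub_IKWindowTransport` (XL).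
-/


noncomputable section


namespace Summit.CriticalPhenomena.CardyFormulaZ2.Theorems.IKLinearTransport.PinnedDiagramExchange

open Summit.CriticalPhenomena.CardyFormulaZ2.Theorems.IKLinearTransport.FarWindowSplit
open Summit.CriticalPhenomena.CardyFormulaZ2.Theorems.IKLinearTransport.PinnedDiagramExchange.QuenchedAssembly
open Summit.CriticalPhenomena.CardyFormulaZ2.Cruxes.IKMixedBoxCrossing.QuenchedChainFKG
  (ApproxHarrisFam QuenchedVarianceDecay approxHarrisFam_of_quenchedLayer stub_quenchedMixture stub_quenchedLogSupermodular
    stub_quenchedHarris stub_approxHarrisFamOfVariance)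

open scoped BigOperators Topology Classical MeasureTheory ProbabilityTheory ENNReal
open Filter Set Function MeasureTheory
open Literature.Probability.Percolation Literature.Probability.LatticeModels
open Literature.Probability.RandomPlanarGeometry

/-! ## §B Registered stubs (the `sorry`s of the line) and the landed v29 assembly stubs -/

/-- STUB (v29; was v8–v22) · `stub_MixedRSW` (EXTERNAL = route crux r4, stmt-CriticalPhenomena-5911, owned by its own line `defect-closure-exploration` v7):
the route decl `IKMixedBoxCrossing` — box crossings at aspect 2 in both directions for every column pattern; after p143979 it is equivalent to its
horizontal clause.  Closes here when `IKMixedBoxCrossing_holds` lands. [folklore] -/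
theorem stub_MixedRSW : Summit.CriticalPhenomena.CardyFormulaZ2.Theses.CardyIKTransport.IKMixedBoxCrossing := by
  sorry

/-- STUB (v31) · `stub_quenchedVarianceDecay` (THE SHARED CORE, research; = stmt-5911 v8 `stub_quenchedVarianceDecay` VERBATIM, def
`QuenchedChainFKG.QuenchedVarianceDecay` of `…IKMixedBoxCrossingQuenchedVarianceDefs.lean`): the environment variance of the QUENCHED crossing probability
of a box at least `n₀ × n₀` is at most `η`, uniformly in the pattern, the box and the enclosing cell rectangle — the one concentration statement to which
the quenched chain-FKG lever reduces approximate Harris (numerically `Var_ξ ≍ n^{-1/2}` for squares, `≍ n^{-0.78}` for the symmetric U-hook, lead c9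
`Ideas/hook-nondegeneracy.md`). [folklore] -/
theorem stub_quenchedVarianceDecay : QuenchedVarianceDecay := by
  sorry

/-- DERIVED (v31; was STUB v29–v30 = `ApproxHarrisFam` verbatim) · `stub_approxHarrisFam`: approximate Harris for families of macroscopic box events,
every pattern — now the sister line's LANDED quenched layer applied to the shared core: exact mixture (M) `stub_quenchedMixture`, log-supermodularity
(L) `stub_quenchedLogSupermodular`, quenched Harris (H) `stub_quenchedHarris`, the telescoping composition (F) `stub_approxHarrisFamOfVariance` (all landed
today under stmt-5911: `…QuenchedMixture/LogSupermodular/Harris/FamOfVariance.lean`) and (V) `stub_quenchedVarianceDecay` — `approxHarrisFam_of_quenchedLayer`. [folklore] -/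
theorem stub_approxHarrisFam : ApproxHarrisFam :=
  approxHarrisFam_of_quenchedLayer stub_quenchedMixture stub_quenchedLogSupermodular stub_quenchedHarris stub_approxHarrisFamOfVariance
    stub_quenchedVarianceDecay

/-- LANDED (v30; was STUB v29, wave c9 worker W1, p165748 `…QuenchedLongCross.lean`) · `stub_longCrossOfHarris`: the ladder. [folklore] -/
theorem stub_longCrossOfHarris : LongCrossOfHarris := QuenchedAssembly.stub_longCrossOfHarris

/-- LANDED (v30; was STUB v29, wave c9 worker W2, p166310 `…QuenchedRingBlocking.lean`) · `stub_ringBlocking`: planar blocking, general diagonals. [folklore] -/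
theorem stub_ringBlocking : RingBlocking := QuenchedAssembly.stub_ringBlocking

/-- LANDED (v30; was STUB v29, wave c9 worker W3, p166629 `…QuenchedRingOfHarris.lean`) · `stub_ringOfHarris`: the frame assembly. [folklore] -/
theorem stub_ringOfHarris : RingOfHarris := QuenchedAssembly.stub_ringOfHarris

/-! ## §C The two RSW residues, now DERIVED (registered names and signatures unchanged since v25) -/

/-- DERIVED (v29; was STUB v25–v28) · `stub_lrCrossAll`: the LEFT–RIGHT clause of the far family for EVERY column pattern at every aspect bound —
`QuenchedAssembly.lrAll_of` from `stub_MixedRSW`, `stub_approxHarrisFam`, `stub_longCrossOfHarris`.  LANDED special cases (unconditional): isotropic-interior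
boxes (`ikFarRSW_lrCross_all_iso`) and honeycomb boxes (`ikFarRSW_cross_all_hon`), every `k` (p146877). [folklore] -/
theorem stub_lrCrossAll : ∀ k : ℕ, ∃ c : ℝ, 0 < c ∧ ∀ (S : Set ℤ) (n : ℕ) (a b : ℤ) (w h : ℕ),
    1 ≤ n → n ≤ w → w ≤ k * n → n ≤ h → h ≤ k * n → c ≤ (νmix S).real (lrCross a b w h) :=
  lrAll_of stub_MixedRSW stub_approxHarrisFam stub_longCrossOfHarris

/-- DERIVED (v29; was STUB v25–v28) · `stub_ringAll`: the RING clause of the far family for EVERY column pattern at every aspect bound —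
`QuenchedAssembly.ringAll_of` from `stub_MixedRSW`, `stub_approxHarrisFam` and the three provable stubs.  LANDED special cases (unconditional): `S = ∅`
(`ikFarRSW_ring_empty`, p146942), honeycomb regions ∀S (`ikFarRSW_ring_hon`, p149042), planar thin rings around wall segments for pure iso
(`WallDomination.thinRing_planar_iso_all`, p161684). [folklore] -/
theorem stub_ringAll : ∀ k : ℕ, ∃ c : ℝ, 0 < c ∧ ∀ (S : Set ℤ) (n : ℕ) (a b : ℤ) (w h : ℕ),
    1 ≤ n → n ≤ w → w ≤ k * n → n ≤ h → h ≤ k * n → c ≤ (νmix S).real {x | ∀ p ∈ monoPaths x false,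
      (∃ u ∈ p, a ≤ u 0 ∧ u 0 < a + w ∧ b ≤ u 1 ∧ u 1 < b + h) → ∀ v ∈ p, v ∉ farFrom a b w h n} :=
  ringAll_iff.1 (ringAll_of stub_MixedRSW stub_approxHarrisFam stub_longCrossOfHarris stub_ringBlocking stub_ringOfHarris)

/-! ## §D Glue of the reshape v25 (sorry-free): the three clause families give the far family -/


/-- THE FAR FAMILY FROM ITS THREE CLAUSES: the left–right, bottom–top and ring families (each `∀ k, ∃ c_k > 0, …`) give
`FarRSWBound (min c) S n a b w h univ` for every aspect bound — `ν_S` is a probability measure, so conditioning on `univ` is void. [folklore] -/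
theorem farFamily_of_clauses
    (hLR : ∀ k : ℕ, ∃ c : ℝ, 0 < c ∧ ∀ (S : Set ℤ) (n : ℕ) (a b : ℤ) (w h : ℕ),
      1 ≤ n → n ≤ w → w ≤ k * n → n ≤ h → h ≤ k * n → c ≤ (νmix S).real (lrCross a b w h))
    (hTB : ∀ k : ℕ, ∃ c : ℝ, 0 < c ∧ ∀ (S : Set ℤ) (n : ℕ) (a b : ℤ) (w h : ℕ),
      1 ≤ n → n ≤ w → w ≤ k * n → n ≤ h → h ≤ k * n → c ≤ (νmix S).real (tbCross a b w h))
    (hR : ∀ k : ℕ, ∃ c : ℝ, 0 < c ∧ ∀ (S : Set ℤ) (n : ℕ) (a b : ℤ) (w h : ℕ),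
      1 ≤ n → n ≤ w → w ≤ k * n → n ≤ h → h ≤ k * n → c ≤ (νmix S).real {x | ∀ p ∈ monoPaths x false,
        (∃ u ∈ p, a ≤ u 0 ∧ u 0 < a + w ∧ b ≤ u 1 ∧ u 1 < b + h) → ∀ v ∈ p, v ∉ farFrom a b w h n}) :
    ∀ k : ℕ, ∃ c : ℝ, 0 < c ∧ ∀ (S : Set ℤ) (n : ℕ), 1 ≤ n → ∀ (a b : ℤ) (w h : ℕ),
      n ≤ w → w ≤ k * n → n ≤ h → h ≤ k * n → FarRSWBound c S n a b w h Set.univ := by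
  intro k
  obtain ⟨c₁, hc₁, h₁⟩ := hLR k
  obtain ⟨c₂, hc₂, h₂⟩ := hTB k
  obtain ⟨c₃, hc₃, h₃⟩ := hR k
  refine ⟨min c₁ (min c₂ c₃), lt_min hc₁ (lt_min hc₂ hc₃), fun S n hn a b w h hw hwk hh hhk _ => ?_⟩
  haveI : IsProbabilityMeasure (νmix S) := isProbabilityMeasure_nuMix S
  simp only [Set.univ_inter, probReal_univ, mul_one]
  exact ⟨(min_le_left _ _).trans (h₁ S n a b w h hn hw hwk hh hhk),
    ((min_le_right _ _).trans (min_le_left _ _)).trans (h₂ S n a b w h hn hw hwk hh hhk),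
    ((min_le_right _ _).trans (min_le_right _ _)).trans (h₃ S n a b w h hn hw hwk hh hhk)⟩


/-! ## The route children (v23 registry), `stub_IKFarRSW` now DERIVED -/

/-- DERIVED (v25; was STUB v23–v24) · `stub_IKFarRSW` (= proposed route child `IKFarRSW` verbatim): the unconditional far RSW family
of the column-mixed IK gauge at all aspect ratios with black rings, uniformly in the column pattern — now the composition of the two
residue stubs `stub_lrCrossAll`, `stub_ringAll` with the LANDED bottom–top family `FarRSWAllAspects.ikFarRSW_tbCross_all` (p146877) through
`farFamily_of_clauses` and the LANDED `IKFarRSW_of_farFamily` (p138980). [folklore] -/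
theorem stub_IKFarRSW :
    let μ := (sitePercolation ℤ half).prod ((sitePercolation ℤ half).prod ((sitePercolation (Site 2) (Set.projIcc (0:ℝ) 1 zero_le_one (2 * Real.sqrt 3 - 3))).prod ((sitePercolation (Site 2) half).prod (sitePercolation (Site 2) half)))); let ν : Set ℤ → Measure (Set (Site 2) × Set (Site 2)) := fun S => μ.map (fun ω => ({v : Site 2 | Xor (v 0 ∈ ω.1) (Xor (v 1 ∈ ω.2.1) (Odd ((Finset.filter (fun f : ℤ × ℤ => ![f.1, f.2] ∈ {f : Site 2 | (f 0 ∈ S ∧ f ∈ ω.2.2.1) ∨ (f 0 ∉ S ∧ f ∈ ω.2.2.2.1)}) (Finset.Ico (min 0 (v 0)) (max 0 (v 0)) ×ˢ Finset.Ico (min 0 (v 1)) (max 0 (v 1)))).card)))}, {f : Site 2 | f 0 ∉ S ∨ f ∈ ω.2.2.2.2})); let edges : (Set (Site 2) × Set (Site 2)) → BondConfig (Site 2) := fun x => {e | ∃ u v, e = s(u, v) ∧ u ∈ x.1 ∧ v ∈ x.1 ∧ (v = u + ![1, 0] ∨ v = u + ![0, 1] ∨ (v = u + ![1, 1] ∧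 ¬ u ∈ x.2) ∨ (v = u + ![1, -1] ∧ (u + ![0, -1]) ∈ x.2))}; let adj : Set (Site 2) → SimpleGraph (Site 2) := fun A => SimpleGraph.fromRel fun u v => v = u + ![1, 0] ∨ v = u + ![0, 1] ∨ (v = u + ![1, 1] ∧ u ∉ A) ∨ (v = u + ![1, -1] ∧ (u + ![0, -1]) ∈ A); ∀ k : ℕ, ∃ c : ℝ, 0 < c ∧ ∀ (S : Set ℤ) (n : ℕ), 1 ≤ n → ∀ (a b : ℤ) (w h : ℕ), n ≤ w → w ≤ k * n → n ≤ h → h ≤ k * n → c ≤ (ν S).real {x | edges x ∈ openCrossing {v : Site 2 | a ≤ v 0 ∧ v 0 < a + w ∧ b ≤ v 1 ∧ v 1 < b + h} {v : Site 2 | v 0 = a ∧ b ≤ v 1 ∧ v 1 < b + h} {v : Site 2 | v 0 = a + w - 1 ∧ b ≤ v 1 ∧ v 1 < b + h}} ∧ c ≤ (ν S).real {x | edges x ∈ openCrossing {v : Site 2 | a ≤ v 0 ∧ v 0 < a + w ∧ b ≤ v 1 ∧ v 1 < b + h} {v : Site 2 | v 1 = b ∧ a ≤ v 0 ∧ v 0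 < a + w} {v : Site 2 | v 1 = b + h - 1 ∧ a ≤ v 0 ∧ v 0 < a + w}} ∧ c ≤ (ν S).real {x | ∀ p : List (Site 2), (p ≠ [] ∧ List.IsChain (adj x.2).Adj p ∧ ∀ v ∈ p, v ∉ x.1) → (∃ u ∈ p, a ≤ u 0 ∧ u 0 < a + w ∧ b ≤ u 1 ∧ u 1 < b + h) → ∀ v ∈ p, ¬ (v 0 < a - n ∨ a + w + n ≤ v 0 ∨ v 1 < b - n ∨ b + h + n ≤ v 1)} :=
  IKFarRSW_of_farFamily (farFamily_of_clauses stub_lrCrossAll FarRSWAllAspects.ikFarRSW_tbCross_all stub_ringAll)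


/-- STUB (v23) · `stub_IKWindowTransport` (size XL, research; = proposed route child `IKWindowTransport` verbatim): the far family ⟹
Manolescu's window coupling (arXiv:2502.08394 §5.3.2–§5.3.6 for the IK gauge WITHOUT FKG: IIC increments as ratio limits, polynomial
IIC mixing, nail law of large numbers, shadowing; every other printed input is landed and discharged). [folklore] -/
theorem stub_IKWindowTransport :
    let μ := (sitePercolation ℤ half).prod ((sitePercolation ℤ half).prod ((sitePercolation (Site 2) (Set.projIcc (0:ℝ) 1 zero_le_one (2 * Real.sqrt 3 - 3))).prod ((sitePercolation (Site 2) half).prod (sitePercolation (Site 2) half)))); let ν : Set ℤ → Measure (Set (Site 2) × Set (Site 2)) := fun S => μ.map (fun ω => ({v : Site 2 | Xor (v 0 ∈ ω.1) (Xor (v 1 ∈ ω.2.1) (Odd ((Finset.filter (fun f : ℤ × ℤ => ![f.1, f.2] ∈ {f : Site 2 | (f 0 ∈ S ∧ f ∈ ω.2.2.1) ∨ (f 0 ∉ S ∧ f ∈ ω.2.2.2.1)}) (Finset.Ico (min 0 (v 0)) (max 0 (v 0)) ×ˢ Finset.Ico (min 0 (v 1)) (max 0 (v 1)))).card)))}, {f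 : Site 2 | f 0 ∉ S ∨ f ∈ ω.2.2.2.2})); let edges : (Set (Site 2) × Set (Site 2)) → BondConfig (Site 2) := fun x => {e | ∃ u v, e = s(u, v) ∧ u ∈ x.1 ∧ v ∈ x.1 ∧ (v = u + ![1, 0] ∨ v = u + ![0, 1] ∨ (v = u + ![1, 1] ∧ ¬ u ∈ x.2) ∨ (v = u + ![1, -1] ∧ (u + ![0, -1]) ∈ x.2))}; let adj : Set (Site 2) → SimpleGraph (Site 2) := fun A => SimpleGraph.fromRel fun u v => v = u + ![1, 0] ∨ v = u + ![0, 1] ∨ (v = u + ![1, 1] ∧ u ∉ A) ∨ (v = u + ![1, -1] ∧ (u + ![0, -1]) ∈ A); let paths : (Set (Site 2) × Set (Site 2)) → Bool → Set (List (Site 2)) := fun x bb => {p | p ≠ [] ∧ List.IsChain (adj x.2).Adj p ∧ ∀ v ∈ p, (v ∈ x.1 ↔ bb = true)}; let pos : ℝ → (Site 2) → ℂ := fun δ v => (δ : ℂ) * (((v 0 : ℝ) : ℂ) + ((v 1 : ℝ) : ℂ) * Complex.I); let shadows : (ℂ ≃L[ℝ] ℂ) → ℝ → ℝ → List (Site 2)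 → Set (List (Site 2)) := fun K δ ε p => {p' | (∀ v ∈ p, ∃ w ∈ p', ‖pos δ w - K (pos δ v)‖ ≤ ε) ∧ (∀ w ∈ p', ∃ v ∈ p, ‖pos δ w - K (pos δ v)‖ ≤ ε) ∧ (∀ v w, p.head? = some v → p'.head? = some w → ‖pos δ w - K (pos δ v)‖ ≤ ε) ∧ (∀ v w, p.getLast? = some v → p'.getLast? = some w → ‖pos δ w - K (pos δ v)‖ ≤ ε)}; let bad : (ℂ ≃L[ℝ] ℂ) → ℝ → ℝ → ℝ → Set ((Set (Site 2) × Set (Site 2)) × (Set (Site 2) × Set (Site 2))) := fun K δ ε ρ => {xx' | ∃ bb : Bool, (∃ p ∈ paths xx'.1 bb, (∀ v ∈ p, ‖pos δ v‖ ≤ ρ) ∧ (∃ v ∈ p, ∃ w ∈ p, ε ≤ ‖pos δ v - pos δ w‖) ∧ ∀ p' ∈ paths xx'.2 bb, p' ∉ shadows K δ ε p) ∨ (∃ p' ∈ paths xx'.2 bb, (∀ v ∈ p', ‖pos δ v‖ ≤ ρ) ∧ (∃ v ∈ p', ∃ w ∈ p', ε ≤ ‖pos δ v - pos δ w‖) ∧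 ∀ p ∈ paths xx'.1 bb, p ∉ shadows K.symm δ ε p')}; (∀ k : ℕ, ∃ c : ℝ, 0 < c ∧ ∀ (S : Set ℤ) (n : ℕ), 1 ≤ n → ∀ (a b : ℤ) (w h : ℕ), n ≤ w → w ≤ k * n → n ≤ h → h ≤ k * n → c ≤ (ν S).real {x | edges x ∈ openCrossing {v : Site 2 | a ≤ v 0 ∧ v 0 < a + w ∧ b ≤ v 1 ∧ v 1 < b + h} {v : Site 2 | v 0 = a ∧ b ≤ v 1 ∧ v 1 < b + h} {v : Site 2 | v 0 = a + w - 1 ∧ b ≤ v 1 ∧ v 1 < b + h}} ∧ c ≤ (ν S).real {x | edges x ∈ openCrossing {v : Site 2 | a ≤ v 0 ∧ v 0 < a + w ∧ b ≤ v 1 ∧ v 1 < b + h} {v : Site 2 | v 1 = b ∧ a ≤ v 0 ∧ v 0 < a + w} {v : Site 2 | v 1 = b + h - 1 ∧ a ≤ v 0 ∧ v 0 < a + w}} ∧ c ≤ (ν S).real {x | ∀ p : List (Site 2), (p ≠ [] ∧ List.IsChain (adj x.2).Adj p ∧ ∀ v ∈ p, v ∉ x.1) → (∃ u ∈ p, a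 ≤ u 0 ∧ u 0 < a + w ∧ b ≤ u 1 ∧ u 1 < b + h) → ∀ v ∈ p, ¬ (v 0 < a - n ∨ a + w + n ≤ v 0 ∨ v 1 < b - n ∨ b + h + n ≤ v 1)}) → ∃ K₁ : ℂ ≃L[ℝ] ℂ, ∀ ε ρ A : ℝ, 0 < ε → 0 < ρ → 0 < A → ∀ᶠ δ in nhdsWithin (0 : ℝ) (Set.Ioi 0), ∃ (S₀ S₁ : Set ℤ) (π : Measure ((Set (Site 2) × Set (Site 2)) × (Set (Site 2) × Set (Site 2)))), (∀ j : ℤ, |j| ≤ (⌈A / δ⌉₊ : ℤ) → j ∈ S₀ ∧ j ∉ S₁) ∧ π.map Prod.fst = ν S₀ ∧ π.map Prod.snd = ν S₁ ∧ π (bad K₁ δ ε ρ) ≤ ENNReal.ofReal ε := by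
  sorry


/-! ## §E Registry continuity (sorry-free given the stubs) -/

/-- v22's `stub_FarRSWInputs` statement is implied by `stub_IKFarRSW` (its r4 hypothesis is not even needed): the reshapes
v22 → v23 → v25 are re-cuts on the RSW side only. [folklore] -/
theorem farRSWInputs_of_IKFarRSW :
    Summit.CriticalPhenomena.CardyFormulaZ2.Theses.CardyIKTransport.IKMixedBoxCrossing →
      ∀ k : ℕ, ∃ c : ℝ, 0 < c ∧ ∀ (S : Set ℤ) (n : ℕ), 1 ≤ n → ∀ (a b : ℤ) (w h : ℕ),
        n ≤ w → w ≤ k * n → n ≤ h → h ≤ k * n → FarRSWBound c S n a b w h Set.univ :=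
  fun _ => farFamily_of_IKFarRSW stub_IKFarRSW

/-- THE SKELETON THEOREM (D-0027 §3.3): concludes the crux `IKLinearTransport` BY NAME, modulo exactly the three registered stubs
`stub_lrCrossAll`, `stub_ringAll`, `stub_IKWindowTransport`, through the LANDED split glue `IKLinearTransport_of_subs` (p138980). -/
theorem IKLinearTransport_of :
    Summit.CriticalPhenomena.CardyFormulaZ2.Theses.CardyIKTransport.IKLinearTransport :=
  IKLinearTransport_of_subs stub_IKFarRSW stub_IKWindowTransport


end Summit.CriticalPhenomena.CardyFormulaZ2.Theorems.IKLinearTransport.PinnedDiagramExchange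

end
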